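import Summits.QuantumFields.BalabanUV.T4Continuum.Support.NE7GaugeStepDeviation
import HarnessLib

/-!
# NE7PointedRepLinearisation — ROAD (B) KINEMATICS, PERTURBATIVE HALF: the pointed gauge `u′ = e^{−σ̃}·u` represents `U^{u′} = W·e^{Z′}`-wise with
# `‖log(W⁻¹U^{u′})(b) − (Z(b) − gaugeDir_W σ̃ (b))‖ ≤ 4(t + δ)(α + δ)` (`‖σ̃‖ ≤ t`, `‖gaugeDir_W σ̃‖ ≤ δ`, `‖Z‖ ≤ α`) — gen 74's gauge-step deviation letter read for the
# extension `c̃ = e^{σ̃}` of the corner values of E′'s gauge; file 37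

Cell `pub-balaban`, rung (B)+1 sub-cell t4, lineage `b2b-balaban-t4-ne7-p1` (CRUX PROVER NE7 #1 = OWNER of row NE7), generation 78; memo
`t4/b2b-balaban-t4-ne7-p1-g78/BUMP-CLASS-FLAT.md` §7.  File F106 (over gen 74's F-file `NE7GaugeStepDeviation.norm_mlog_gaugeStep_sub_linear_le`:
`‖log(e^{T}e^{A}e^{−T′}) − (A − (T′ − T))‖ ≤ 4(‖T‖ + ‖T′−T‖)(‖A‖ + ‖T′−T‖)`, and `NE3FluxGradientDictionary.Ad_exp_eq`).
WHY (memo §7).  F105 gives the exact half of road (B): for E′'s representative `U^u = We^{Z}` and a smooth unitary extension `c̃ = e^{σ̃}` of the corner values of `u`,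
the pointed gauge `u′ := c̃⁻¹u` keeps the top of `U` and `U^{u′} = W^{c̃⁻¹}e^{Ad Z}` exactly.  THIS FILE reads the same field against the ORIGINAL background `W`: bond by
bond `W(b)⁻¹U^{u′}(b) = e^{Ad_{W(b)⁻¹}(−σ̃(x))}·e^{Z(b)}·e^{σ̃(x+e_μ)}`, so gen 74's deviation letter gives `log(W⁻¹U^{u′}) = Z − gaugeDir_W σ̃ + N` with
`‖N‖ ≤ 4(t + δ)(α + δ)` — `t ≍ θ_u`, `δ ≍ θ_u∕M` (smooth `σ̃`), `α ≍ α̂∕M`: `N = O(θ_u(α̂ + θ_u)∕M)`, an `O(θ_u)`-RELATIVE perturbation of the expansion field, carrying the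
finite conjugation `Ad_{c̃⁻¹}Z − Z`.  The docking twin of F86 at `(W, Z − gaugeDir_W σ̃ + N)` and the Hessian letter for gauge directions are the successor's files.
WHAT ([folklore]; 0 def, 0 sorry).  §1 `relLink_pointed_eq` (the bond identity); §2 **`norm_mlog_relLink_pointed_sub_le`** (the deviation bound).
HONEST FRAMING (page 1): `exp`∕`log` kinematics by name over the tree; nothing analytic; nothing of Bałaban's asserted; (APE) NOT proved; NOT ONE-STEP, NOT NE7; spine 0∕9;
finite T⁴ rung (B)+1 — NOT infinite volume, NOT mass gap, NOT `BetaPertH`, NOT Clay.  Continuum YM on T⁴ ⇐ BetaPertH ∧ nine spine estimates (0/9 proved); BetaPertH ⇐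
(D1) ∧ (D4) ∧ CAP+tail; G-an2-4 gates asym, D1 and NE2/3/4.
-/

set_option autoImplicit false

open scoped BigOperators Matrix Matrix.Norms.L2Operator
open NormedSpace Finset

namespace Summit.QuantumFields.BalabanUV.T4Continuum.NE7PointedRepLinearisation

open Literature.MathematicalPhysics.QuantumFieldTheory.Balaban1983to89
open B7Prop1Explicit B7Prop2Explicit MatrixLog
open T4AveragingDeficitWall (Ad IsUnitaryCfg IsSkewDir vary)
open AveragingDeficitTransport (norm_Ad_of_unitary Ad_mem_skewAdjoint)
open BlockAveragePushDirGauge (gaugeDir)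
open NE3FluxGradientDictionary (Ad_exp_eq)
open NE7GaugeStepDeviation (norm_mlog_gaugeStep_sub_linear_le)

noncomputable section

variable {d : ℕ} {n : Type*} [Fintype n] [DecidableEq n]

/-! ## §1 The relative link of the pointed gauge against the original background -/

/-- **THE BOND IDENTITY**: if `U^u = vary W Z 1` and `u′ = e^{−σ̃}·u`, then
`W(b)⁻¹·U^{u′}(b) = e^{Ad_{W(b)⁻¹}(−σ̃(x))}·e^{Z(b)}·e^{−(−σ̃(x+e_μ))}`. [folklore] -/
theorem relLink_pointed_eq {u : Site d → (Matrix n n ℂ)ˣ} {U W : Site d → Fin d → (Matrix n n ℂ)ˣ} {Z : Site d → Fin d → Matrix n n ℂ}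
    (hrep : gaugeAct u U = vary W Z 1) (σ : Site d → Matrix n n ℂ) (x : Site d) (μ : Fin d) :
    (((W x μ)⁻¹ * gaugeAct (fun y => (expUnit (σ y))⁻¹ * u y) U x μ : (Matrix n n ℂ)ˣ) : Matrix n n ℂ)
      = exp (Ad (W x μ)⁻¹ (-σ x)) * exp (Z x μ) * exp (-(-σ (x + e μ))) := by
  have hb : (gaugeAct u U x μ : (Matrix n n ℂ)ˣ) = vary W Z 1 x μ := by rw [hrep]
  have e1 : gaugeAct (fun y => (expUnit (σ y))⁻¹ * u y) U x μ = (expUnit (σ x))⁻¹ * gaugeAct u U x μ * expUnit (σ (x + e μ)) := by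
    simp only [gaugeAct, mul_inv_rev, inv_inv, mul_assoc]
  rw [e1, hb]
  simp only [vary, Units.val_mul, val_inv_expUnit, val_expUnit, Complex.ofReal_one, one_smul, neg_neg]
  rw [← Ad_exp_eq]
  simp only [Ad]
  noncomm_ring

/-! ## §2 The deviation bound -/

/-- **THE POINTED REPRESENTATIVE AGAINST THE ORIGINAL BACKGROUND, TO FIRST ORDER**: for unitary `W`, skew `σ̃` with `‖σ̃(x)‖ ≤ t`, `‖gaugeDir_W σ̃ (x, μ)‖ ≤ δ`,
`‖Z(x, μ)‖ ≤ α` (`t, α, δ ≤ 1∕40`) and `U^u = vary W Z 1`: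
`‖log(W(b)⁻¹U^{u′}(b)) − (Z(b) − gaugeDir_W σ̃ (b))‖ ≤ 4(t + δ)(α + δ)` for `u′ = e^{−σ̃}u`. [folklore] -/
theorem norm_mlog_relLink_pointed_sub_le [Nonempty n] {u : Site d → (Matrix n n ℂ)ˣ} {U W : Site d → Fin d → (Matrix n n ℂ)ˣ} (hWu : IsUnitaryCfg W)
    {Z : Site d → Fin d → Matrix n n ℂ} (hrep : gaugeAct u U = vary W Z 1)
    {σ : Site d → Matrix n n ℂ} (hσs : ∀ y, σ y ∈ skewAdjoint (Matrix n n ℂ))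
    {t α δ : ℝ} (ht : ∀ y, ‖σ y‖ ≤ t) (hα : ∀ (y : Site d) (κ : Fin d), ‖Z y κ‖ ≤ α)
    (hδ : ∀ (y : Site d) (κ : Fin d), ‖gaugeDir W σ y κ‖ ≤ δ) (ht40 : t ≤ 1 / 40) (hα40 : α ≤ 1 / 40) (hδ40 : δ ≤ 1 / 40)
    (x : Site d) (μ : Fin d) :
    ‖mlog ((((W x μ)⁻¹ * gaugeAct (fun y => (expUnit (σ y))⁻¹ * u y) U x μ : (Matrix n n ℂ)ˣ) : Matrix n n ℂ))
        - (Z x μ - gaugeDir W σ x μ)‖ ≤ 4 * (t + δ) * (α + δ) := by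
  rw [relLink_pointed_eq hrep σ x μ]
  -- gen 74's letter with `T = Ad_{W⁻¹}(−σ̃ x)`, `A = Z(b)`, `T′ = −σ̃(x + e_μ)`
  have hWi : (W x μ)⁻¹ ∈ unitaryUnits (Matrix n n ℂ) := (unitaryUnits _).inv_mem (hWu x μ)
  have hTs : Ad (W x μ)⁻¹ (-σ x) ∈ skewAdjoint (Matrix n n ℂ) := Ad_mem_skewAdjoint hWi ((skewAdjoint _).neg_mem (hσs x))
  have hTn : ‖Ad (W x μ)⁻¹ (-σ x)‖ ≤ t := by rw [norm_Ad_of_unitary hWi, norm_neg]; exact ht x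
  have hD : ‖-σ (x + e μ) - Ad (W x μ)⁻¹ (-σ x)‖ ≤ δ := by
    have e1 : -σ (x + e μ) - Ad (W x μ)⁻¹ (-σ x) = gaugeDir W σ x μ := by
      simp only [gaugeDir, Ad, mul_neg, neg_mul, sub_neg_eq_add]; abel
    rw [e1]; exact hδ x μ
  have h := norm_mlog_gaugeStep_sub_linear_le hTs hTn (hα x μ) hD ht40 hα40 hδ40
  have e2 : Z x μ - (-σ (x + e μ) - Ad (W x μ)⁻¹ (-σ x)) = Z x μ - gaugeDir W σ x μ := by
    simp only [gaugeDir, Ad, mul_neg, neg_mul, sub_neg_eq_add]; abel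
  rw [e2] at h
  exact h

end

end Summit.QuantumFields.BalabanUV.T4Continuum.NE7PointedRepLinearisation
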